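/-
Origin: expansion seat `planner-pub-hodgecm-mc-axioms-1-g14-0`, handover #W56 2026-08-20T15:53:55Z md5 eeab3d96c428 (PKG b5c104a725f8 → eeab3d96c428; 148 l.; MECHANICAL (iib-R) rewrite v3.1 of the PKG file as it stands (1 token edits; rules R3x1)) (`HOME/mc/pub-hodgecm-mc-axioms-1-g14/revendor/kit-r55/stage55/HodgeCM/Model/ThetaSpaceTranslate.lean`, md5 eeab3d96c428, 148 lines);
landed by the gen-22 packager (p-g22) in gate run 55 REPLACES the earlier landed copy of `HodgeCM/Model/ThetaSpaceTranslate.lean` (seat copy carried the packager Origin header of an earlier run (stripped)).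
-/
/-
Origin: CONSTRUCTION seat `planner-pub-hodgecm-mc-period-1-g3-0` (unit pub-hodgecm-mc-period-1-g3, gen 3 of
mc-period-1, period lane), 2026-08-19.  NEW additive leaf `HodgeCM/Model/ThetaSpaceTranslate.lean`.
Imports: mc-theta-3-g3's `HodgeCM.Model.ThetaSpace` (`KTypeSituation`, `thetaSpaceOf`) and the vendored twin
of the tree leaf (H⁵) `Literature/NumberTheory/Automorphic/ThetaFormsRationalTranslate.lean` (this seat).
No proof holes, no new hypotheses minted: the only inputs are the rationality data of the translating element
(`ιinf γ₁ · k ∈ P.ΓU`, `k` centralising `ιinf (G₁)`) and the level relation `γ₁ Δ' γ₁⁻¹ ⊆ Δ`.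
Expected `#print axioms`: {propext, Classical.choice, Quot.sound}.
-/
import Summits.HodgeConjecture.HodgeCM.Model.ThetaSpace
import Literature.NumberTheory.Automorphic.ThetaFormsRationalTranslate

/-!
# The classical theta spaces under rational translation

For the pair data `P : WeilPairData K L J GU`, an archimedean situation `ιinf : G₁ →* GU` and a level
`Δ ≤ G₁`, mc-theta-3's `thetaSpaceOf P ιinf Δ κ₁ τ₁ 𝓕 = ⨆ S, S.forms 𝓕` is the span of the archimedean
restrictions `x ↦ F(ιinf x)` of all adelic theta forms of the pair (over all `K`-type situations `S`).

**Result** (`exists_mem_thetaSpaceOf_coe_eq_leftTranslate`): for `γ₁ ∈ G₁` RATIONAL with respect to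
`(ιinf, P.ΓU)` — `ιinf γ₁ · k ∈ P.ΓU` for some `k ∈ GU` commuting with `ιinf (G₁)` (its finite-adelic
component) — and any level `Δ'` with `γ₁ Δ' γ₁⁻¹ ⊆ Δ`, every `F ∈ thetaSpaceOf P ιinf Δ κ₁ τ₁ 𝓕` has its left
translate `x ↦ F (γ₁ x)` in `thetaSpaceOf P ιinf Δ' κ₁ τ₁ 𝓕`.  This is the hypothesis `hΘ` of
`UnitaryBallUniformisationDatum.exists_mem_thetaClasses_classLift_eq_translate_of_apply_eq` (mc-autform-2's (C3),
`Model/ClassMapTranslate`) for the pinned theta sets (`ιinf := id` downstairs), i.e. the theta-side input of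
the E binder `transl` ("Hecke translates of theta one-forms are theta one-forms").

Mechanism (tree (H⁵)): upstairs the translate is the Hecke translate `R(k⁻¹)` into the CONJUGATED weight group
`κₖ = (conj k⁻¹) ∘ κ` (`WeightForms.isLevelCorrected_of_conj`, `isWeightMatched_of_conj`), Hecke translates of
theta forms are theta forms for translated test families (`ThetaKernelDatum.map_rightTranslateHom_thetaForms_le`),
and the translated families EXIST as linear maps because the pair's Weil action is by linear operators
(`hasThetaTranslates`: `j' := ω(k⁻¹, 1) ∘ j`, `ThetaKernelDatum.isThetaTranslate_of_act` by `rfl` on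
`WeilPairData.kernelDatum = adelicOfDualPairRep …`).  The translated situation is `KTypeSituation.translate`.
-/

noncomputable section

open MeasureTheory NumberField NumberField.mixedEmbedding IsDedekindDomain
open Literature.NumberTheory.Automorphic Literature.NumberTheory.Weil1964
open Literature.NumberTheory.Automorphic.WeightForms (restrictHom IsLevelCorrected IsWeightMatched leftTranslateHom
  isLevelCorrected_of_conj isWeightMatched_of_conj conj_mul_inv_eq conj_comp_apply)
open HodgeCM.PerL34.Seesaw HodgeCM.PerL34.RationalCoset HodgeCM.PerL34.SupplyAdelic
open HodgeCM.Model.SupplyInstance HodgeCM.Model.SupplyResidual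

namespace HodgeCM
namespace Model
namespace ThetaSpace

section Translate

variable {K L : Type} [Field K] [NumberField K] [Field L] [NumberField L] [Algebra K L] [FiniteDimensional K L]
variable {J : Type} [Fintype J] {GU : Type} [Group GU] [TopologicalSpace GU] [IsTopologicalGroup GU]
  [LocallyCompactSpace GU]
variable (P : WeilPairData K L J GU)
variable {G₁ K₁ W : Type} [Group G₁] [Group K₁] [AddCommGroup W] [Module ℂ W]
variable {ιinf : G₁ →* GU} {Δ Δ' : Subgroup G₁} {κ₁ : K₁ →* G₁} {τ₁ : Representation ℂ K₁ W}

/-- **Translates of test families exist**: every linear family of test vectors `j : E → 𝒮` has an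
`h`-translate `j'` as a linear family (`Θ_{j'(e)}(S) = Θ_{j(e)}(S · s(h, 1))`). -/
def HasThetaTranslates : Prop :=
  ∀ (h : GU) (E : Type) [AddCommGroup E] [Module ℂ E] (j : E →ₗ[ℂ] P.weilDatum.ThetaTop),
    ∃ j' : E →ₗ[ℂ] P.weilDatum.ThetaTop, P.kernelDatum.IsThetaTranslate h j j'

/-- The pair data HAS translates: its Weil action is the linear representation `ω`, so `j' := ω(h, 1) ∘ j`
serves (`adelicOfDualPair_act`, `adelicOfDualPair_s` are `rfl`). -/
theorem hasThetaTranslates : HasThetaTranslates P := by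
  intro h E _ _ j
  exact ⟨(P.ω (h, 1) : piSchwartzBruhat K J →ₗ[ℂ] piSchwartzBruhat K J) ∘ₗ j,
    P.kernelDatum.isThetaTranslate_of_act fun _ => rfl⟩

variable {P} [CompactSpace (GU ⧸ P.ΓU)] [Module.IsReflexive ℂ W]

/-- **The translated situation**: same `K`-type data, weight group conjugated by the finite component `k`
(`κₖ c = k⁻¹ κ(c) k`), level `Δ'` with `γ₁ Δ' γ₁⁻¹ ⊆ Δ`, test families the `k⁻¹`-translates of those of `S`. -/
def KTypeSituation.translate (S : KTypeSituation P ιinf Δ κ₁ τ₁) {γ₁ : G₁} {k : GU}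
    (hγ : ιinf γ₁ * k ∈ P.ΓU) (hk : ∀ x : G₁, Commute k (ιinf x)) (hΔ' : ∀ δ' ∈ Δ', γ₁ * δ' * γ₁⁻¹ ∈ Δ) :
    KTypeSituation P ιinf Δ' κ₁ τ₁ where
  Kc := S.Kc
  κ := (MulAut.conj k⁻¹).toMonoidHom.comp S.κ
  E := S.E
  σ := S.σ
  τ := S.τ
  ι := S.ι
  hι := S.hι
  η₁ := S.η₁
  hΔ := isLevelCorrected_of_conj ιinf S.hΔ hγ hk (conj_comp_apply (κ := S.κ) k) hΔ'
  hη := isWeightMatched_of_conj ιinf S.hη hk (conj_comp_apply (κ := S.κ) k)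
  𝓙 := {j' | ∃ j ∈ S.𝓙, P.kernelDatum.IsThetaTranslate k⁻¹ j.1 j'.1}

/-- **Left translation by a rational element maps a situation's restricted theta forms into those of the
translated situation.** -/
theorem KTypeSituation.map_leftTranslateHom_forms_le (S : KTypeSituation P ιinf Δ κ₁ τ₁)
    (hT : HasThetaTranslates P) {γ₁ : G₁} {k : GU} (hγ : ιinf γ₁ * k ∈ P.ΓU)
    (hk : ∀ x : G₁, Commute k (ιinf x)) (hΔ' : ∀ δ' ∈ Δ', γ₁ * δ' * γ₁⁻¹ ∈ Δ)
    (𝓕 : Set C(relNormOneIdeles K L ⧸ relNormOneRat K L, ℂ)) :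
    (S.forms 𝓕).map (leftTranslateHom γ₁ hΔ') ≤ (S.translate hγ hk hΔ').forms 𝓕 := by
  unfold KTypeSituation.forms KTypeSituation.thetaForms
  refine ThetaKernelDatum.map_leftTranslateHom_map_restrictHom_thetaForms_le P.kernelDatum S.κ
    ((MulAut.conj k⁻¹).toMonoidHom.comp S.κ) (MonoidHom.id S.Kc) (probHaarRelNormOneQuot K L)
    P.kernelDatum_thetaLinear S.ι S.hι S.hι ιinf hγ hk hΔ'
    (conj_mul_inv_eq (conj_comp_apply (κ := S.κ) k)) (fun _ => rfl) (fun _ => rfl) ?_ 𝓕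
  intro j hj
  obtain ⟨j', hj'⟩ := hT k⁻¹ S.E j.1
  exact ⟨⟨j', hj'.isThetaEquivariant_of_conj P.kernelDatum j.2
    (conj_mul_inv_eq (conj_comp_apply (κ := S.κ) k)) (fun _ => rfl)⟩, ⟨j, hj, hj'⟩, hj'⟩

/-- **The classical theta spaces are stable under rational translation, level moved**: for `ιinf γ₁ · k ∈ P.ΓU`
(`k` centralising `ιinf (G₁)`) and `γ₁ Δ' γ₁⁻¹ ⊆ Δ`, left translation by `γ₁` maps `thetaSpaceOf … Δ …` into
`thetaSpaceOf … Δ' …`. -/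
theorem map_leftTranslateHom_thetaSpaceOf_le {γ₁ : G₁} {k : GU} (hγ : ιinf γ₁ * k ∈ P.ΓU)
    (hk : ∀ x : G₁, Commute k (ιinf x)) (hΔ' : ∀ δ' ∈ Δ', γ₁ * δ' * γ₁⁻¹ ∈ Δ)
    (𝓕 : Set C(relNormOneIdeles K L ⧸ relNormOneRat K L, ℂ)) :
    (thetaSpaceOf P ιinf Δ κ₁ τ₁ 𝓕).map (leftTranslateHom γ₁ hΔ') ≤ thetaSpaceOf P ιinf Δ' κ₁ τ₁ 𝓕 := by
  unfold thetaSpaceOf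
  rw [Submodule.map_iSup]
  exact iSup_le fun S => (S.map_leftTranslateHom_forms_le (hasThetaTranslates P) hγ hk hΔ' 𝓕).trans
    (forms_le_thetaSpaceOf (S.translate hγ hk hΔ') 𝓕)

/-- **The same, one form at a time** (the `hΘ` of `Model.exists_mem_thetaClasses_classLift_eq_translate_of_apply_eq`
at the pin): every `F` in the theta space of level `Δ` has `F' : x ↦ F (γ₁ x)` in the theta space of level `Δ'`. -/
theorem exists_mem_thetaSpaceOf_coe_eq_leftTranslate {γ₁ : G₁} {k : GU} (hγ : ιinf γ₁ * k ∈ P.ΓU)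
    (hk : ∀ x : G₁, Commute k (ιinf x)) (hΔ' : ∀ δ' ∈ Δ', γ₁ * δ' * γ₁⁻¹ ∈ Δ)
    (𝓕 : Set C(relNormOneIdeles K L ⧸ relNormOneRat K L, ℂ)) {F : weightForms Δ κ₁ τ₁}
    (hF : F ∈ thetaSpaceOf P ιinf Δ κ₁ τ₁ 𝓕) :
    ∃ F' ∈ thetaSpaceOf P ιinf Δ' κ₁ τ₁ 𝓕, (F' : G₁ → W) = fun x => (F : G₁ → W) (γ₁ * x) :=
  ⟨leftTranslateHom γ₁ hΔ' F, map_leftTranslateHom_thetaSpaceOf_le hγ hk hΔ' 𝓕 (Submodule.mem_map_of_mem hF),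
    rfl⟩

/-- Pointwise form: `∀ x, F' x = F (γ₁ x)`. -/
theorem exists_mem_thetaSpaceOf_apply_eq_leftTranslate {γ₁ : G₁} {k : GU} (hγ : ιinf γ₁ * k ∈ P.ΓU)
    (hk : ∀ x : G₁, Commute k (ιinf x)) (hΔ' : ∀ δ' ∈ Δ', γ₁ * δ' * γ₁⁻¹ ∈ Δ)
    (𝓕 : Set C(relNormOneIdeles K L ⧸ relNormOneRat K L, ℂ)) {F : weightForms Δ κ₁ τ₁}
    (hF : F ∈ thetaSpaceOf P ιinf Δ κ₁ τ₁ 𝓕) :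
    ∃ F' ∈ thetaSpaceOf P ιinf Δ' κ₁ τ₁ 𝓕, ∀ x : G₁, (F' : G₁ → W) x = (F : G₁ → W) (γ₁ * x) :=
  ⟨leftTranslateHom γ₁ hΔ' F, map_leftTranslateHom_thetaSpaceOf_le hγ hk hΔ' 𝓕 (Submodule.mem_map_of_mem hF),
    fun _ => rfl⟩

end Translate

end ThetaSpace
end Model
end HodgeCM

end
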